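import Literature.Probability.LatticeModels.BlockExplorationNested
import Literature.Probability.LatticeModels.RandomClusterRimWiringOutside
import Literature.Probability.Percolation.BlockExplorationBasic
import HarnessLib

/-!
# The top-level identity of Kesten's ratio-limit scheme, rim wired off the inside (proved)

Topic `Literature/Probability/LatticeModels`; the "off the inside" companion of
`BlockExplorationTop.lean` (`openConn_eq_sum_add_notWired`), built on
`Literature/Probability/Percolation/BlockExploration*.lean` (the exploration from inside of
D. Basu, A. Sapozhnikov, ECP 22 (2017), §2: explored set `𝒞 = explSet In Blk ω`, rim
`𝒟 = explRim In Blk ω`, datum event `explEvent In Blk U R = {𝒞 = U, 𝒟 = R}`), on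
`BlockExplorationNested.lean` (`explEvent_wired_rimHyps`) and on
`RandomClusterRimWiringOutside.lean` (`rcMeasure_real_condIndep_of_rim_wired_outside`: conditional
independence of the configurations on and off the edges touching the explored set).

For the free random-cluster measure `P = φ_{G,p,q}` of a finite graph `G`, an inner set `In ∋ x`, a
block `Blk` and a far vertex `y ∉ In ∪ Blk`, write, for a datum `d = (U, R)`,
`F d = {𝒞 = U, 𝒟 = R, rim wired through U ∖ In}` (on the configuration restricted to `E(G)`; the
wiring paths are required to AVOID the inside `In`, so that the datum event is determined by the
edges avoiding `In` — this is what makes the family nest over scales, faithful to Basu–Sapozhnikov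
where the wiring comes from the unique crossing cluster of an annulus off the inside),
`InP d = {x joined inside U to a vertex carrying an open edge to R}` (inside piece) and
`OutP d = {some rim vertex joined to y by an open path avoiding U}` (outside piece). Then
(`openConn_eq_sum_add_notWiredOff`)

  `P[x ↔ y] = Σ_d P[F d ∩ OutP d] · (P[F d ∩ InP d] / P[F d])`
              `+ P[{x ↔ y} ∩ {rim not wired off In}]`:

partition `{x ↔ y}` according to the actual datum `(𝒞, 𝒟)` (the events `F d` are pairwise
disjoint and, together with `{rim not wired off In}`, exhaust everything); on `F d` the rim is in
particular wired through `U` (`openConnIn` is monotone in its set), so the connection splits as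
`InP d ∩ OutP d` (`openConn_iff_of_mem_explEvent`), `InP d` is determined by the edges touching `U`
and `OutP d` by the other edges, and the rim-wiring Markov property factorises
`P[F d ∩ InP d ∩ OutP d] · P[F d] = P[F d ∩ InP d] · P[F d ∩ OutP d]`. This is Kesten's
"`P[x ↔ y] = Σ t(d) u_x(d) + junk`" (H. Kesten, PTRF 73 (1986), proof of Thm. 3, eqs. (15)–(17))
in the planarity-free form of Basu–Sapozhnikov (§2, eq. (2.4)).

Everything is proved; no definitions, no named facts.

## References
* [BasuSapozhnikov2017ECP] D. Basu, A. Sapozhnikov, *Kesten's incipient infinite cluster and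
  quasi-multiplicativity of crossing probabilities*, Electron. Commun. Probab. 22 (2017) no. 26,
  §2, eq. (2.4).
* [Kesten1986] H. Kesten, The incipient infinite cluster in two-dimensional percolation,
  *Probab. Theory Related Fields* 73 (1986) 369–394, proof of Thm. 3, eqs. (15)–(17).
* G. Grimmett, *The Random-Cluster Model*, Springer (2006), §4.2, Lemma (4.13).
-/

open MeasureTheory Finset SimpleGraph
open Literature.Probability.Percolation (BondConfig openConn openConnIn explSet explRim explEvent explRimWired)

namespace Literature.Probability.LatticeModels

/-! ### Event algebra -/

/-- Membership in the saturated datum event wired off the inside, read on the exploration data: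
the restricted configuration has explored set `U`, rim `R`, and its rim is wired through `U ∖ In`.
[cite: BasuSapozhnikov2017ECP, §2 eq. (2.4)] -/
private theorem topOff_mem_wiredEvent_iff {V : Type*} {E : Set (Sym2 V)} {In Blk U R : Set V}
    {ω : BondConfig V} :
    ω ∈ {ω : BondConfig V | ω ∩ E ∈ explEvent In Blk U R ∩
        {ω | ∀ r ∈ R, ∀ r₂ ∈ R, ∃ v ∈ U \ In, ∃ v' ∈ U \ In,
          s(v, r) ∈ ω ∧ s(v', r₂) ∈ ω ∧ ω ∈ openConnIn (U \ In) v v'}} ↔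
      explSet In Blk (ω ∩ E) = U ∧ explRim In Blk (ω ∩ E) = R ∧
        ∀ r ∈ explRim In Blk (ω ∩ E), ∀ r₂ ∈ explRim In Blk (ω ∩ E),
          ∃ v ∈ explSet In Blk (ω ∩ E) \ In, ∃ v' ∈ explSet In Blk (ω ∩ E) \ In,
            s(v, r) ∈ ω ∩ E ∧ s(v', r₂) ∈ ω ∩ E ∧
              ω ∩ E ∈ openConnIn (explSet In Blk (ω ∩ E) \ In) v v' := by
  constructor
  · rintro ⟨⟨hU, hR⟩, hw⟩
    subst hU hR
    exact ⟨rfl, rfl, hw⟩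
  · rintro ⟨rfl, rfl, hw⟩
    exact ⟨⟨rfl, rfl⟩, hw⟩

/-- Wiring of the rim through `U ∖ In` implies wiring through `U` (`openConnIn` is monotone in
its set). [folklore] -/
private theorem topOff_wire_mono {V : Type*} {In U R : Set V} {ω : BondConfig V}
    (h : ∀ r ∈ R, ∀ r₂ ∈ R, ∃ v ∈ U \ In, ∃ v' ∈ U \ In,
      s(v, r) ∈ ω ∧ s(v', r₂) ∈ ω ∧ ω ∈ openConnIn (U \ In) v v') :
    ∀ r ∈ R, ∀ r₂ ∈ R, ∃ v ∈ U, ∃ v' ∈ U,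
      s(v, r) ∈ ω ∧ s(v', r₂) ∈ ω ∧ ω ∈ openConnIn U v v' := by
  intro r hr r₂ hr₂
  obtain ⟨v, hv, v', hv', h1, h2, h3⟩ := h r hr r₂ hr₂
  exact ⟨v, hv.1, v', hv'.1, h1, h2, Percolation.openConnIn_mono Set.sdiff_subset v v' h3⟩

/-- The datum event wired off the inside lies in the datum event wired through the whole explored
set. [cite: BasuSapozhnikov2017ECP, §2 eq. (2.4)] -/
private theorem topOff_subset_wired {V : Type*} {E : Set (Sym2 V)} {In Blk U R : Set V} :
    {ω : BondConfig V | ω ∩ E ∈ explEvent In Blk U R ∩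
        {ω | ∀ r ∈ R, ∀ r₂ ∈ R, ∃ v ∈ U \ In, ∃ v' ∈ U \ In,
          s(v, r) ∈ ω ∧ s(v', r₂) ∈ ω ∧ ω ∈ openConnIn (U \ In) v v'}} ⊆
      {ω : BondConfig V | ω ∩ E ∈ explEvent In Blk U R ∩
        {ω | ∀ r ∈ R, ∀ r₂ ∈ R, ∃ v ∈ U, ∃ v' ∈ U,
          s(v, r) ∈ ω ∧ s(v', r₂) ∈ ω ∧ ω ∈ openConnIn U v v'}} :=
  fun _ hω => ⟨hω.1, topOff_wire_mono hω.2⟩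

/-- The inside piece `{∃ w ∈ R, ∃ v ∈ U, x ↔ v inside U, vw open}` (on the configuration restricted
to `E`) passes between configurations agreeing on a set of pairs `T` containing every pair of `E`
issuing from `U`. [cite: Kesten1986, proof of Thm. 3, eqs. (15)–(17)] -/
private theorem topOff_inP_of_agree {V : Type*} {E T : Set (Sym2 V)} {U R : Set V} {x : V}
    (hT : ∀ a ∈ U, ∀ b : V, s(a, b) ∈ E → s(a, b) ∈ T) {ω₁ ω₂ : BondConfig V}
    (h : ω₁ ∩ T = ω₂ ∩ T)
    (h₁ : ∃ w ∈ R, ∃ v ∈ U, ω₁ ∩ E ∈ openConnIn U x v ∧ s(v, w) ∈ ω₁ ∩ E) :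
    ∃ w ∈ R, ∃ v ∈ U, ω₂ ∩ E ∈ openConnIn U x v ∧ s(v, w) ∈ ω₂ ∩ E := by
  have key : ∀ a ∈ U, ∀ b : V, s(a, b) ∈ ω₁ ∩ E → s(a, b) ∈ ω₂ ∩ E := by
    intro a ha b hab
    have h' : s(a, b) ∈ ω₁ ∩ T := ⟨hab.1, hT a ha b hab.2⟩
    rw [h] at h'
    exact ⟨h'.1, hab.2⟩
  obtain ⟨w, hw, v, hv, hxv, hvw⟩ := h₁
  exact ⟨w, hw, v, hv, Percolation.BlockExploration.openConnIn_of_agree hxv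
    fun a ha b _ hab => key a ha b hab, key v hv w hvw⟩

/-- The outside piece `{∃ w ∈ R, w ↔ y avoiding U}` (on the configuration restricted to `E`)
passes between configurations agreeing on a set of pairs `D` containing every pair of `E` with
both endpoints off `U`. [cite: Kesten1986, proof of Thm. 3, eqs. (15)–(17)] -/
private theorem topOff_outP_of_agree {V : Type*} {E D : Set (Sym2 V)} {U R : Set V} {y : V}
    (hD : ∀ a, a ∉ U → ∀ b, b ∉ U → s(a, b) ∈ E → s(a, b) ∈ D) {ω₁ ω₂ : BondConfig V}
    (h : ω₁ ∩ D = ω₂ ∩ D) (h₁ : ∃ w ∈ R, ω₁ ∩ E ∈ openConnIn Uᶜ w y) :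
    ∃ w ∈ R, ω₂ ∩ E ∈ openConnIn Uᶜ w y := by
  obtain ⟨w, hw, hwy⟩ := h₁
  refine ⟨w, hw, Percolation.BlockExploration.openConnIn_of_agree hwy fun a ha b hb hab => ?_⟩
  have h' : s(a, b) ∈ ω₁ ∩ D := ⟨hab.1, hD a ha b hb hab.2⟩
  rw [h] at h'
  exact ⟨h'.1, hab.2⟩

/-! ### The hypotheses of the rim-wiring Markov property -/

/-- **The datum event wired off the inside satisfies the hypotheses of the rim-wiring Markov
property** at the explored set `U` with rim `R`: it is determined by the `G`-edges `T` touching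
`U` (the datum event is, by `mem_explEvent_iff_of_agree_on_touching`, and the wiring clause only
looks at pairs issuing from `U ∖ In ⊆ U`); on it every open `T`-edge leaving `U` ends in `R`, and
any two rim vertices are joined through open `T`-edges (weaken the wiring to one through `U`,
`explEvent_wired_rimHyps`). [cite: BasuSapozhnikov2017ECP, §2 eq. (2.4)] -/
private theorem topOff_rimHyps {V : Type*} [Fintype V] [DecidableEq V] (G : SimpleGraph V)
    [DecidableRel G.Adj] (In Blk U R : Set V) (T : Finset (Sym2 V))
    (hT : ∀ e, e ∈ T ↔ e ∈ G.edgeFinset ∧ ∃ v ∈ U, v ∈ e) (F : Set (BondConfig V))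
    (hF : F = {ω | ω ∩ (↑G.edgeFinset : Set (Sym2 V)) ∈ explEvent In Blk U R ∩
      {ω | ∀ r ∈ R, ∀ r₂ ∈ R, ∃ v ∈ U \ In, ∃ v' ∈ U \ In,
        s(v, r) ∈ ω ∧ s(v', r₂) ∈ ω ∧ ω ∈ openConnIn (U \ In) v v'}}) :
    (∀ ω₁ ω₂ : BondConfig V, ω₁ ∩ ↑T = ω₂ ∩ ↑T → (ω₁ ∈ F ↔ ω₂ ∈ F)) ∧
      (∀ ω ∈ F, ∀ e ∈ ω, e ∈ T → ∀ x ∈ e, x ∉ U → x ∈ R) ∧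
      (∀ ω ∈ F, ∀ x ∈ R, ∀ y ∈ R, (fromEdgeSet (ω ∩ ↑T)).Reachable x y) := by
  obtain ⟨-, hFrim, hFwire⟩ := explEvent_wired_rimHyps G In Blk U R T hT
  subst hF
  refine ⟨fun ω₁ ω₂ h12 => ?_, fun ω hω => hFrim ω (topOff_subset_wired hω),
    fun ω hω => hFwire ω (topOff_subset_wired hω)⟩
  -- the saturated configurations agree on every pair touching `U`
  have hag : ∀ e : Sym2 V, (∃ v ∈ U, v ∈ e) →
      (e ∈ ω₁ ∩ (↑G.edgeFinset : Set (Sym2 V)) ↔ e ∈ ω₂ ∩ (↑G.edgeFinset : Set (Sym2 V))) := by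
    intro e he
    by_cases heE : e ∈ G.edgeFinset
    · have heT : e ∈ T := (hT e).2 ⟨heE, he⟩
      have h : e ∈ ω₁ ∩ (↑T : Set (Sym2 V)) ↔ e ∈ ω₂ ∩ (↑T : Set (Sym2 V)) := by rw [h12]
      simp only [Set.mem_inter_iff, Finset.mem_coe, heT, and_true] at h
      simp only [Set.mem_inter_iff, Finset.mem_coe, heE, and_true]
      exact h
    · simp only [Set.mem_inter_iff, Finset.mem_coe, heE, and_false]
  -- the wiring clause passes between configurations agreeing on the pairs touching `U`
  have hwire : ∀ {ωa ωb : BondConfig V},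
      (∀ e : Sym2 V, (∃ v ∈ U, v ∈ e) → (e ∈ ωa ↔ e ∈ ωb)) →
      (∀ r ∈ R, ∀ r₂ ∈ R, ∃ v ∈ U \ In, ∃ v' ∈ U \ In,
        s(v, r) ∈ ωa ∧ s(v', r₂) ∈ ωa ∧ ωa ∈ openConnIn (U \ In) v v') →
      ∀ r ∈ R, ∀ r₂ ∈ R, ∃ v ∈ U \ In, ∃ v' ∈ U \ In,
        s(v, r) ∈ ωb ∧ s(v', r₂) ∈ ωb ∧ ωb ∈ openConnIn (U \ In) v v' := by
    intro ωa ωb hag h r hr r₂ hr₂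
    obtain ⟨v, hv, v', hv', h1, h2, h3⟩ := h r hr r₂ hr₂
    exact ⟨v, hv, v', hv', (hag _ ⟨v, hv.1, Sym2.mem_mk_left v r⟩).1 h1,
      (hag _ ⟨v', hv'.1, Sym2.mem_mk_left v' r₂⟩).1 h2,
      Percolation.BlockExploration.openConnIn_of_agree h3 fun a ha b _ hab =>
        (hag _ ⟨a, ha.1, Sym2.mem_mk_left a b⟩).1 hab⟩
  show ω₁ ∩ ↑G.edgeFinset ∈ explEvent In Blk U R ∩ _ ↔
    ω₂ ∩ ↑G.edgeFinset ∈ explEvent In Blk U R ∩ _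
  rw [Set.mem_inter_iff, Set.mem_inter_iff,
    Percolation.mem_explEvent_iff_of_agree_on_touching hag]
  exact and_congr_right fun _ => ⟨hwire hag, hwire fun e he => (hag e he).symm⟩

/-! ### Arithmetic of the conditional factorisation -/

/-- If `D = A ∩ C` on `F`, `F` is not null and `μ(F ∩ A ∩ C) μ(F) = μ(F ∩ A) μ(F ∩ C)`, then
`μ(F ∩ D) = μ(F ∩ C) · (μ(F ∩ A) / μ(F))`. [folklore] -/
private theorem topOff_cond_arith {α : Type*} [MeasurableSpace α] {μ : Measure α}
    {F A C D : Set α} (h0 : μ.real F ≠ 0) (hD : ∀ ω ∈ F, ω ∈ D ↔ ω ∈ A ∧ ω ∈ C)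
    (hM : μ.real (F ∩ A ∩ C) * μ.real F = μ.real (F ∩ A) * μ.real (F ∩ C)) :
    μ.real (F ∩ C) * (μ.real (F ∩ A) / μ.real F) = μ.real (F ∩ D) := by
  have hset : F ∩ D = F ∩ A ∩ C := by
    ext ω
    simp only [Set.mem_inter_iff]
    constructor
    · rintro ⟨hF, hωD⟩
      exact ⟨⟨hF, ((hD ω hF).1 hωD).1⟩, ((hD ω hF).1 hωD).2⟩
    · rintro ⟨⟨hF, hA⟩, hC⟩
      exact ⟨hF, (hD ω hF).2 ⟨hA, hC⟩⟩
  rw [hset, ← mul_div_assoc, div_eq_iff h0, hM, mul_comm]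

/-! ### The summand: factorisation on one datum event -/

/-- **On one datum event wired off the inside the connection factorises.** For `x ∈ In`,
`y ∉ In ∪ Blk` and the saturated datum event `F = {𝒞 = U, 𝒟 = R, rim wired through U ∖ In}` of
the free random-cluster measure `P`: `P[F ∩ OutP] · (P[F ∩ InP] / P[F]) = P[F ∩ {x ↔ y}]`. On `F`
the rim is in particular wired through `U`, so `{x ↔ y} = InP ∩ OutP`
(`openConn_iff_of_mem_explEvent`); `InP` is determined by the edges touching `U`, `OutP` by the
other edges, and the rim-wiring Markov property (`rcMeasure_real_condIndep_of_rim_wired_outside`,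
hypotheses from `topOff_rimHyps`) factorises.
[cite: Kesten1986, proof of Thm. 3, eqs. (15)–(17)] -/
private theorem topOff_summand_eq {V : Type*} [Fintype V] [DecidableEq V] (G : SimpleGraph V)
    [DecidableRel G.Adj] {p q : ℝ} (hp : p ∈ Set.Icc (0 : ℝ) 1) (hq : 0 < q) {In Blk : Set V}
    (U R : Set V) {x y : V} (hx : x ∈ In) (hy : y ∉ In ∪ Blk) (F : Set (BondConfig V))
    (hF : F = {ω | ω ∩ (↑G.edgeFinset : Set (Sym2 V)) ∈ explEvent In Blk U R ∩
      {ω | ∀ r ∈ R, ∀ r₂ ∈ R, ∃ v ∈ U \ In, ∃ v' ∈ U \ In,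
        s(v, r) ∈ ω ∧ s(v', r₂) ∈ ω ∧ ω ∈ openConnIn (U \ In) v v'}}) :
    (rcMeasure G p q ∅).real
          (F ∩ {ω | ∃ w ∈ R, ω ∩ (↑G.edgeFinset : Set (Sym2 V)) ∈ openConnIn Uᶜ w y}) *
        ((rcMeasure G p q ∅).real (F ∩ {ω | ∃ w ∈ R, ∃ v ∈ U,
            ω ∩ (↑G.edgeFinset : Set (Sym2 V)) ∈ openConnIn U x v ∧
              s(v, w) ∈ ω ∩ (↑G.edgeFinset : Set (Sym2 V))}) /
          (rcMeasure G p q ∅).real F) =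
      (rcMeasure G p q ∅).real
        (F ∩ {ω | ω ∩ (↑G.edgeFinset : Set (Sym2 V)) ∈ openConn x y}) := by
  classical
  haveI := isProbabilityMeasure_rcMeasure G hp hq ∅
  by_cases hF0 : (rcMeasure G p q ∅).real F = 0
  · -- a null datum event contributes nothing
    rw [hF0, div_zero, mul_zero]
    exact (measureReal_mono_null Set.inter_subset_left hF0).symm
  -- `F` is nonempty: read off `x ∈ U`, `y ∉ U` and `R ∩ U = ∅` from one of its configurations
  obtain ⟨ω₀, hω₀⟩ : F.Nonempty :=
    Set.nonempty_iff_ne_empty.2 fun h => hF0 (by rw [h, measureReal_empty])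
  -- the `G`-edges touching `U`, and the three hypotheses of the Markov property
  obtain ⟨T, hT⟩ : ∃ T : Finset (Sym2 V), ∀ e, e ∈ T ↔ e ∈ G.edgeFinset ∧ ∃ v ∈ U, v ∈ e :=
    ⟨G.edgeFinset.filter (fun e => ∃ v ∈ U, v ∈ e), fun e => Finset.mem_filter⟩
  obtain ⟨hFdet, hFrim, hFwire⟩ := topOff_rimHyps G In Blk U R T hT F hF
  subst hF
  obtain ⟨hU₀, hR₀, -⟩ := topOff_mem_wiredEvent_iff.1 hω₀
  have hxU : x ∈ U := by
    rw [← hU₀]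
    exact Percolation.subset_explSet In Blk _ hx
  have hyU : y ∉ U := by
    rw [← hU₀]
    exact fun h => hy (Percolation.explSet_subset In Blk _ h)
  have hRU : ∀ r ∈ R, r ∉ U := by
    rw [← hU₀, ← hR₀]
    exact fun r hr hrU => (Percolation.mem_explRim_iff.1 hr).1 hrU
  have hTU : ∀ a ∈ U, ∀ b : V, s(a, b) ∈ (↑G.edgeFinset : Set (Sym2 V)) →
      s(a, b) ∈ (↑T : Set (Sym2 V)) := fun a ha b hab =>
    Finset.mem_coe.2 ((hT _).2 ⟨Finset.mem_coe.1 hab, a, ha, Sym2.mem_mk_left a b⟩)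
  have hDU : ∀ a, a ∉ U → ∀ b, b ∉ U → s(a, b) ∈ (↑G.edgeFinset : Set (Sym2 V)) →
      s(a, b) ∈ (↑(G.edgeFinset \ T) : Set (Sym2 V)) := by
    intro a ha b hb hab
    refine Finset.mem_coe.2 (Finset.mem_sdiff.2 ⟨Finset.mem_coe.1 hab, fun hT' => ?_⟩)
    obtain ⟨-, v, hv, hve⟩ := (hT _).1 hT'
    rcases Sym2.mem_iff.1 hve with rfl | rfl
    exacts [ha hv, hb hv]
  -- the Markov property for the inside piece `A` and the outside piece `C`, and (E7) on `F`
  refine topOff_cond_arith hF0 (fun ω hω => ?_)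
    (rcMeasure_real_condIndep_of_rim_wired_outside G hp hq ∅ U R T hT hRU
      (fun b hb => (Set.notMem_empty b hb).elim) _ hFdet hFrim hFwire _ _
      (fun ω₁ ω₂ h => ⟨topOff_inP_of_agree hTU h, topOff_inP_of_agree hTU h.symm⟩)
      (fun ω₁ ω₂ h => ⟨topOff_outP_of_agree hDU h, topOff_outP_of_agree hDU h.symm⟩))
  obtain ⟨hU, hR, hW⟩ := topOff_mem_wiredEvent_iff.1 hω
  exact Percolation.openConn_iff_of_mem_explEvent ⟨hU, hR⟩
    (Percolation.explRimLinked_of_explRimWired (topOff_wire_mono hW)) hxU hyU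

/-! ### The partition by the exploration data -/

/-- Splitting of indicator masses: if `PS ↔ PW` then `[PA] = [PS ∧ PA] + [PA ∧ ¬ PW]`.
[folklore] -/
private theorem topOff_ite_split {c : ℝ} {PA PS PW : Prop} {_ : Decidable PA}
    {_ : Decidable (PS ∧ PA)} {_ : Decidable (PA ∧ ¬ PW)} (h : PS ↔ PW) :
    (if PA then c else 0) = (if PS ∧ PA then c else 0) + (if PA ∧ ¬ PW then c else 0) := by
  by_cases hA : PA <;> by_cases hW : PW <;> simp [hA, hW, h]

/-- **Partition by the exploration data.** For every event `A` of the free random-cluster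
measure `P` of `G`: `P[A] = Σ_{d = (U, R)} P[F d ∩ A] + P[A ∩ {rim not wired off In}]`, where
`F d` is the saturated datum event wired off the inside — every configuration lies in the datum
event of its own `(𝒞, 𝒟)` and in no other, and lies in the wired one iff its rim is wired through
`𝒞 ∖ In`; the measure is a finite sum of point masses, so the identity is checked configuration
by configuration. [cite: BasuSapozhnikov2017ECP, §2 eq. (2.4)] -/
private theorem topOff_real_eq_sum_add {V : Type*} [Fintype V] [DecidableEq V]
    (G : SimpleGraph V) [DecidableRel G.Adj] {p q : ℝ} (hp : p ∈ Set.Icc (0 : ℝ) 1) (hq : 0 < q)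
    (In Blk : Set V) (A : Set (BondConfig V)) :
    (rcMeasure G p q ∅).real A =
      (∑ d ∈ (Finset.univ : Finset (Finset V × Finset V)),
        (rcMeasure G p q ∅).real
          ({ω | ω ∩ (↑G.edgeFinset : Set (Sym2 V)) ∈
              explEvent In Blk (↑d.1 : Set V) (↑d.2 : Set V) ∩
            {ω | ∀ r ∈ (↑d.2 : Set V), ∀ r₂ ∈ (↑d.2 : Set V), ∃ v ∈ (↑d.1 : Set V) \ In,
              ∃ v' ∈ (↑d.1 : Set V) \ In, s(v, r) ∈ ω ∧ s(v', r₂) ∈ ω ∧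
                ω ∈ openConnIn ((↑d.1 : Set V) \ In) v v'}} ∩
            A)) +
        (rcMeasure G p q ∅).real
          (A ∩ {ω | ¬ (∀ r ∈ explRim In Blk (ω ∩ (↑G.edgeFinset : Set (Sym2 V))),
            ∀ r₂ ∈ explRim In Blk (ω ∩ (↑G.edgeFinset : Set (Sym2 V))),
            ∃ v ∈ explSet In Blk (ω ∩ (↑G.edgeFinset : Set (Sym2 V))) \ In,
            ∃ v' ∈ explSet In Blk (ω ∩ (↑G.edgeFinset : Set (Sym2 V))) \ In,
              s(v, r) ∈ ω ∩ (↑G.edgeFinset : Set (Sym2 V)) ∧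
              s(v', r₂) ∈ ω ∩ (↑G.edgeFinset : Set (Sym2 V)) ∧
              ω ∩ (↑G.edgeFinset : Set (Sym2 V)) ∈
                openConnIn (explSet In Blk (ω ∩ (↑G.edgeFinset : Set (Sym2 V))) \ In) v v')}) := by
  classical
  simp only [rcMeasure_real_apply G hp hq ∅]
  rw [Finset.sum_comm, ← Finset.sum_add_distrib]
  refine Finset.sum_congr rfl fun η _ => ?_
  -- the datum of the configuration `↑η`
  obtain ⟨d₀, hd₁, hd₂⟩ : ∃ d₀ : Finset V × Finset V,
      (↑d₀.1 : Set V) = explSet In Blk ((↑η : BondConfig V) ∩ ↑G.edgeFinset) ∧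
        (↑d₀.2 : Set V) = explRim In Blk ((↑η : BondConfig V) ∩ ↑G.edgeFinset) :=
    ⟨((Set.toFinite _).toFinset, (Set.toFinite _).toFinset), Set.Finite.coe_toFinset _,
      Set.Finite.coe_toFinset _⟩
  rw [Finset.sum_eq_single d₀]
  · exact topOff_ite_split
      (topOff_mem_wiredEvent_iff.trans ⟨fun h => h.2.2, fun hW => ⟨hd₁.symm, hd₂.symm, hW⟩⟩)
  · intro d _ hne
    refine if_neg fun hd => hne ?_
    obtain ⟨h1, h2, -⟩ := topOff_mem_wiredEvent_iff.1 hd.1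
    exact Prod.ext (Finset.coe_inj.1 (h1.symm.trans hd₁.symm))
      (Finset.coe_inj.1 (h2.symm.trans hd₂.symm))
  · exact fun h => absurd (Finset.mem_univ _) h

/-! ### The top-level identity -/

/-- **The top-level identity of Kesten's ratio-limit scheme, rim wired off the inside**
(Kesten 1986, proof of Thm. 3, eqs. (15)–(17); Basu–Sapozhnikov 2017, §2, eq. (2.4),
planarity-free). For the free random-cluster measure `P` of a finite graph `G` (`0 ≤ p ≤ 1`,
`q > 0`), an inner set `In ∋ x`, a block `Blk` and a far vertex `y ∉ In ∪ Blk`: with `F d` the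
saturated datum event of `d = (U, R)` whose rim is wired through `U ∖ In` (OFF the inside), `InP d`
the inside piece (`x` joined inside `U` to a vertex carrying an open edge to `R`) and `OutP d` the
outside piece (a rim vertex joined to `y` avoiding `U`),
`P[x ↔ y] = Σ_d P[F d ∩ OutP d] · (P[F d ∩ InP d] / P[F d]) + P[{x ↔ y} ∩ {rim not wired off In}]`
— the connection probability is a `t`-weighted sum of the CONDITIONAL inside probabilities
`u_x(d) = P[F d ∩ InP d] / P[F d]` (graph-independent by the Markov property), up to the mass of
the configurations whose rim is not wired off the inside.
[cite: BasuSapozhnikov2017ECP, §2 eq. (2.4)] -/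
theorem openConn_eq_sum_add_notWiredOff :
    ∀ {V : Type*} [Fintype V] [DecidableEq V] (G : SimpleGraph V) [DecidableRel G.Adj] {p q : ℝ},
      p ∈ Set.Icc (0 : ℝ) 1 → 0 < q →
    ∀ (In Blk : Set V) (x y : V),
      x ∈ In → y ∉ In → y ∉ Blk → (∀ v ∈ In ∪ Blk, ¬ G.Adj v y) →
      (∀ v ∈ In, ∀ w : V, G.Adj v w → w ∈ In ∪ Blk) →
      let Eg : Set (Sym2 V) := ↑G.edgeFinset
      let P := rcMeasure G p q ∅
      let F : Set V → Set V → Set (BondConfig V) := fun U R => {ω | ω ∩ Eg ∈ explEvent In Blk U R ∩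
        {ω | ∀ r ∈ R, ∀ r₂ ∈ R, ∃ v ∈ U \ In, ∃ v' ∈ U \ In, s(v, r) ∈ ω ∧ s(v', r₂) ∈ ω ∧ ω ∈ openConnIn (U \ In) v v'}}
      let InP : Set V → Set V → Set (BondConfig V) := fun U R =>
        {ω | ∃ w ∈ R, ∃ v ∈ U, ω ∩ Eg ∈ openConnIn U x v ∧ s(v, w) ∈ ω ∩ Eg}
      let OutP : Set V → Set V → Set (BondConfig V) := fun U R =>
        {ω | ∃ w ∈ R, ω ∩ Eg ∈ openConnIn Uᶜ w y}
      let NW : Set (BondConfig V) := {ω | ¬ (∀ r ∈ explRim In Blk (ω ∩ Eg), ∀ r₂ ∈ explRim In Blk (ω ∩ Eg),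
        ∃ v ∈ explSet In Blk (ω ∩ Eg) \ In, ∃ v' ∈ explSet In Blk (ω ∩ Eg) \ In,
          s(v, r) ∈ ω ∩ Eg ∧ s(v', r₂) ∈ ω ∩ Eg ∧ ω ∩ Eg ∈ openConnIn (explSet In Blk (ω ∩ Eg) \ In) v v')}
      P.real {ω | ω ∩ Eg ∈ openConn x y} =
        (∑ d ∈ (Finset.univ : Finset (Finset V × Finset V)),
          P.real (F ↑d.1 ↑d.2 ∩ OutP ↑d.1 ↑d.2) *
            (P.real (F ↑d.1 ↑d.2 ∩ InP ↑d.1 ↑d.2) / P.real (F ↑d.1 ↑d.2))) +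
          P.real ({ω | ω ∩ Eg ∈ openConn x y} ∩ NW) := by
  intro V _ _ G _ p q hp hq In Blk x y hx hyIn hyBlk _ _
  have hy : y ∉ In ∪ Blk := fun h => h.elim hyIn hyBlk
  refine (topOff_real_eq_sum_add G hp hq In Blk _).trans ?_
  congr 1
  exact Finset.sum_congr rfl fun d _ => (topOff_summand_eq G hp hq _ _ hx hy _ rfl).symm

end Literature.Probability.LatticeModels
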